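import Summits.NavierStokesRegularity.FluidComputer.PeriodicProfileSingularPoint
import HarnessLib

/-!
# An exactly discretely self-similar object in an arbitrary clock blows up at the TYPE-I rate —
# never Type II — and its blow-up time is a singular time (Seregin's vocabulary)

Summit `NavierStokesRegularity`, cell topic directory `FluidComputer`, namespace
`…FluidComputer.SelfSimilarCensus`; zone Z7 of the D-0081 profile search («generalised self-similar
with logarithmic correction (DSS / log-periodic ansatz)»). Companion of
`PeriodicProfileSingularPoint.lean` (a `P`-periodic profile `W(σ, ·)` in an ARBITRARY clock solving
the momentum equation at the clock times: DSS at every physical time of a terminal interval,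
unbounded on every backward parabolic cylinder at the blow-up point `(T, 0)`) and of
`PeriodicProfileClockRigidity.lean` (`0 < m ≤ (T − θ)ℓ² ≤ M` — Leray's gauge up to a bounded
periodic factor). Here: the second print a census row asks of a blow-up candidate, the RATE, in the
tree's Seregin vocabulary (`Literature.Analysis.FluidPDE.IsTypeIBlowup`, `IsTypeIIBlowup`,
`IsRegularPoint`, `IsSingularTime` of `SuitableWeak.lean`). PROVED theorems only; no definitions,
no named facts.

## Content (standing hypotheses = `PeriodicProfileClockRigidity` §4 + bounded physical time `θ → T`)

* §1 `periodicProfile_sqrt_mul_norm_ge` — the profile is carried at EXACTLY the self-similar rate,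
  from below: `√m · ‖W(σ, y)‖ ≤ √(T − θ(σ)) · ‖u(θ(σ), ℓ(σ)⁻¹ • y)‖` for every `σ > σ₀`, `y`.
* §1 **`periodicProfile_isTypeIBlowup`** — a sup-bounded profile (`‖W(σ, y)‖ ≤ K`) gives
  `‖u(t, x)‖ ≤ K√M/√(T − t)` for every physical time `t` of a terminal interval and every `x`, i.e.
  the tree's `IsTypeIBlowup u T` (Seregin 2012 §1); hence **`periodicProfile_not_isTypeIIBlowup`**:
  `¬ IsTypeIIBlowup u T`.
* §2 `periodicProfile_continuousOn` — the object is JOINTLY CONTINUOUS on every terminal slab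
  `(θ(σ₁), T) × E`, from the ansatz alone (the inverse clock `invFunOn θ (Ioi σ₀)` is monotone with
  open image, hence continuous; it appears in that proof only — every statement keeps `σ` primary).
* §3 MEASURE VOCABULARY (`IsRegularPoint` / `IsSingularTime` are essential-supremum notions;
  positivity of `volume` on open sets of `ℝ × E` is an instance hypothesis, automatic on `ℝ³`):
  `norm_le_of_ae_norm_le_parabolicCylinder` (essential ⇒ pointwise bound for a continuous field),
  **`periodicProfile_not_isRegularPoint`** (`(T, 0)` is not a regular point — no hypothesis beyond
  the standing ones), **`periodicProfile_isSingularTime`** (`IsSingularTime u T`).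

READING for the Z7 row (lead's pen): an EXACT DSS object in ANY clock blows up at exactly the
self-similar rate — it never prints «V-T2 = Type II» — so a mechanism that must be Type II (e.g. by
an axisymmetric Type-I exclusion) is not an exact DSS object with a bounded profile; logarithmic
corrections to the RATE, like those to the gauge (`periodicProfile_blowup_rigidity`), live on
drifting (non-periodic) profiles only.

WHAT THIS IS NOT: not an existence or non-existence claim for DSS profiles, not a statement about
which branch a Navier–Stokes evolution takes, not Navier–Stokes evidence; boundedness of the profile
(§1) is a hypothesis where used; `violates:` none — no object. Tree search: `lean search 'IsTypeIBlowup|IsTypeIIBlowup|IsSingularTime'`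
— the definitions (`SuitableWeak`), `IsBackwardSingularPoint.not_isRegularPoint` (`LocalTypeI`), the
Scheffer/Ożański NSI glue (`not_isRegularPoint_glue`); nothing for a (discretely) self-similar
ansatz.

## References (context; the statements are folklore consequences of the scaling symmetry)

* G. Seregin, Comm. Pure Appl. Math. 65 (2012), §1 (Type I / Type II; regular points).
  [Seregin2012]
* L. Caffarelli, R. Kohn, L. Nirenberg, Comm. Pure Appl. Math. 35 (1982), §6 (regular points).
  [CaffarelliKohnNirenberg1982]
* D. Chae, J. Wolf, Arch. Rational Mech. Anal. 225 (2017), §3 step 1. [ChaeWolf2017RemovingDSS]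
-/

noncomputable section

open Set Filter Topology InnerProductSpace Function Metric MeasureTheory
open scoped Laplacian RealInnerProductSpace ENNReal

namespace Summit.NavierStokesRegularity.FluidComputer.SelfSimilarCensus

open Literature.Analysis.FluidPDE

section PeriodicProfile

variable {E : Type*} [NormedAddCommGroup E] [InnerProductSpace ℝ E] [FiniteDimensional ℝ E]
variable {W : ℝ → E → E} {Q : ℝ → E → ℝ} {u : ℝ → E → E} {p : ℝ → E → ℝ}
  {ℓ ℓ' θ : ℝ → ℝ} {ν P σ₀ T : ℝ}

/-! Standing hypotheses = those of `PeriodicProfileClockRigidity` §4 / `PeriodicProfileSingularPoint`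
§3, verbatim: on the open half-line `σ > σ₀` the clock has `ℓ > 0` with derivative `ℓ′` and
`θ′ = ℓ⁻²`; `P > 0`; the profile `W` is jointly `C¹` and `P`-periodic in `σ` with every slice
`W(σ, ·) ≢ 0`, the similarity pressure `Q` is `P`-periodic; at the clock times `θ(σ)` the physical
fields are the modulated ansatz `u(θ(σ), x) = ℓ(σ) • W(σ, ℓ(σ) • x)`,
`p(θ(σ), x) = ℓ(σ)² Q(σ, ℓ(σ) • x)`, `t ↦ u(t, x)` is differentiable, and
`∂ₜu + (u·∇)u + ∇p − νΔu = 0` (`ν : ℝ` arbitrary). The blow-up branch adds bounded physical time,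
`θ(σ) → T` (hypothesis `hT` of each theorem). -/
variable (hP : 0 < P) (hℓ : ∀ σ, σ₀ < σ → HasDerivAt ℓ (ℓ' σ) σ) (hpos : ∀ σ, σ₀ < σ → 0 < ℓ σ)
  (hθ : ∀ σ, σ₀ < σ → HasDerivAt θ ((ℓ σ ^ 2)⁻¹) σ) (hW : ContDiff ℝ 1 (uncurry W))
  (hper : ∀ s, W (s + P) = W s) (hperQ : ∀ s, Q (s + P) = Q s)
  (hW0 : ∀ σ, σ₀ < σ → W σ ≠ 0)
  (hans : ∀ σ, σ₀ < σ → ∀ x, u (θ σ) x = ℓ σ • W σ (ℓ σ • x))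
  (hp : ∀ σ, σ₀ < σ → p (θ σ) = fun x => ℓ σ ^ 2 * Q σ (ℓ σ • x))
  (hu : ∀ σ, σ₀ < σ → ∀ x, DifferentiableAt ℝ (fun t => u t x) (θ σ))
  (heq : ∀ σ, σ₀ < σ → ∀ x : E,
    timeDeriv u (θ σ) x + convect (u (θ σ)) (u (θ σ)) x + gradient (p (θ σ)) x -
      ν • (Δ (u (θ σ))) x = 0)
include hP hℓ hpos hθ hW hper hperQ hW0 hans hp hu heq

/-! ### §1 The rate: exactly self-similar — Type I, never Type II -/

/-- **The profile is carried at exactly the self-similar rate (lower bound).** With the constants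
`0 < m ≤ (T − θ(σ))ℓ(σ)²` of `periodicProfile_blowup_rigidity`: for every `σ > σ₀` and every `y`,
`√m · ‖W(σ, y)‖ ≤ √(T − θ(σ)) · ‖u(θ(σ), ℓ(σ)⁻¹ • y)‖` — along the clock, `√(T − t) · sup|u(t)|`
never drops below `√m` times the profile's values. [folklore] -/
theorem periodicProfile_sqrt_mul_norm_ge (hT : Tendsto θ atTop (𝓝 T)) :
    ∃ m : ℝ, 0 < m ∧ ∀ σ, σ₀ < σ → ∀ y : E,
      Real.sqrt m * ‖W σ y‖ ≤ Real.sqrt (T - θ σ) * ‖u (θ σ) ((ℓ σ)⁻¹ • y)‖ := by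
  obtain ⟨c, -, -, -, hlt, -, m, M, hm, -, hbd⟩ :=
    periodicProfile_blowup_rigidity hP hℓ hpos hθ hW hper hperQ hW0 hans hp hu heq hT
  refine ⟨m, hm, fun σ hσ y => ?_⟩
  have hℓσ := hpos σ hσ
  have hTσ : 0 ≤ T - θ σ := (sub_pos.2 (hlt σ hσ)).le
  rw [hans σ hσ, smul_smul, mul_inv_cancel₀ hℓσ.ne', one_smul, norm_smul,
    Real.norm_of_nonneg hℓσ.le, ← mul_assoc]
  refine mul_le_mul_of_nonneg_right ?_ (norm_nonneg _)
  rw [← Real.sqrt_sq hℓσ.le, ← Real.sqrt_mul hTσ]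
  exact Real.sqrt_le_sqrt (hbd σ hσ).1

/-- **A SUP-BOUNDED PROFILE BLOWS UP AT THE TYPE-I RATE.** If `‖W(σ, y)‖ ≤ K` for all `σ > σ₀` and
all `y`, then on the blow-up branch `‖u(t, x)‖ ≤ K√M/√(T − t)` for every physical time
`t ∈ (θ(σ₀ + 1), T)` and every `x` (`M` the upper constant of `periodicProfile_blowup_rigidity`:
`ℓ ≤ √M/√(T − θ)`), i.e. the tree's `IsTypeIBlowup u T` (Seregin 2012, §1): an exact DSS object in
any clock is Type I in time — the `(T − t)^{-1/2}` law carries no logarithmic or other correction.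
[cite: Seregin2012, §1] -/
theorem periodicProfile_isTypeIBlowup (hT : Tendsto θ atTop (𝓝 T)) {K : ℝ}
    (hK : ∀ σ, σ₀ < σ → ∀ y : E, ‖W σ y‖ ≤ K) : IsTypeIBlowup u T := by
  obtain ⟨c, -, -, -, hlt, -, m, M, hm, hmM, hbd⟩ :=
    periodicProfile_blowup_rigidity hP hℓ hpos hθ hW hper hperQ hW0 hans hp hu heq hT
  have h1 : σ₀ < σ₀ + 1 := lt_add_one σ₀
  have hK0 : 0 ≤ K := (norm_nonneg _).trans (hK (σ₀ + 1) h1 0)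
  have hM : 0 ≤ M := hm.le.trans hmM
  refine ⟨K * Real.sqrt M, ?_⟩
  have hnhds : Ioo (θ (σ₀ + 1)) T ∈ 𝓝[<] T := Ioo_mem_nhdsLT (periodicProfile_time_lt hP hpos hθ hT h1)
  filter_upwards [hnhds] with t ht x
  obtain ⟨σ, hσ, rfl⟩ := periodicProfile_exists_clockTime hθ hT h1 ht
  have hσ₀ : σ₀ < σ := h1.trans hσ
  have hℓσ := hpos σ hσ₀
  have hTσ : 0 < T - θ σ := sub_pos.2 (hlt σ hσ₀)
  -- `ℓ(σ) ≤ √M / √(T − θ σ)`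
  have hℓle : ℓ σ ≤ Real.sqrt M / Real.sqrt (T - θ σ) := by
    rw [le_div_iff₀ (Real.sqrt_pos.2 hTσ), ← Real.sqrt_sq hℓσ.le, ← Real.sqrt_mul (sq_nonneg _)]
    exact Real.sqrt_le_sqrt (by nlinarith [(hbd σ hσ₀).2])
  rw [hans σ hσ₀, norm_smul, Real.norm_of_nonneg hℓσ.le]
  calc ℓ σ * ‖W σ (ℓ σ • x)‖ ≤ (Real.sqrt M / Real.sqrt (T - θ σ)) * K :=
        mul_le_mul hℓle (hK σ hσ₀ _) (norm_nonneg _) (by positivity)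
    _ = K * Real.sqrt M / Real.sqrt (T - θ σ) := by ring

/-- **Hence never Type II** (tree `IsTypeIIBlowup u T := IsSingularTime u T ∧ ¬ IsTypeIBlowup u T`,
Seregin 2012, §1; the measure structure on `E` enters only through that definition). A census
candidate that must be Type II is therefore not an exact DSS object with a bounded profile.
[cite: Seregin2012, §1] -/
theorem periodicProfile_not_isTypeIIBlowup [MeasureSpace E] (hT : Tendsto θ atTop (𝓝 T)) {K : ℝ}
    (hK : ∀ σ, σ₀ < σ → ∀ y : E, ‖W σ y‖ ≤ K) : ¬ IsTypeIIBlowup u T :=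
  fun h => h.2 (periodicProfile_isTypeIBlowup hP hℓ hpos hθ hW hper hperQ hW0 hans hp hu heq hT hK)

/-! ### §2 The object is jointly continuous on a terminal slab (the inverse clock, used only here) -/

omit hP hℓ hW hper hperQ hW0 hans hp hu heq in
/-- The clock's physical time is strictly increasing on the whole open half-line `σ > σ₀`.
[folklore] -/
theorem periodicProfile_strictMonoOn_time_Ioi : StrictMonoOn θ (Ioi σ₀) := by
  intro a ha b _ hab
  exact periodicProfile_strictMonoOn_time hpos hθ ha (show a ∈ Ici a from self_mem_Ici)
    (show b ∈ Ici a from hab.le) hab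

omit [FiniteDimensional ℝ E] hper hperQ hW0 hp hu heq in
/-- **Joint continuity of the object near the blow-up time, from the ansatz.** On the blow-up
branch, for every `σ₁ > σ₀` the field `(t, x) ↦ u(t, x)` is continuous on the terminal slab
`(θ(σ₁), T) × E`: there `u(t, x) = ℓ(τ(t)) • W(τ(t), ℓ(τ(t)) • x)` with the inverse clock
`τ = θ⁻¹` (`Function.invFunOn θ (Ioi σ₀)`), which is monotone on `(θ(σ₁), T)` with image
`⊇ (σ₁, ∞)`, hence continuous (`continuousAt_of_monotoneOn_of_image_mem_nhds`); `ℓ` is continuous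
and `W` jointly `C¹`. The inverse clock appears in this proof only. [folklore] -/
theorem periodicProfile_continuousOn (hT : Tendsto θ atTop (𝓝 T)) {σ₁ : ℝ} (hσ₁ : σ₀ < σ₁) :
    ContinuousOn (uncurry u) (Ioo (θ σ₁) T ×ˢ (univ : Set E)) := by
  have hmono := periodicProfile_strictMonoOn_time_Ioi hpos hθ
  set V : Set ℝ := Ioo (θ σ₁) T with hV
  set τ : ℝ → ℝ := invFunOn θ (Ioi σ₀) with hτ
  -- on `V`, `τ` inverts the clock and lands in `σ > σ₁`
  have hex : ∀ t ∈ V, ∃ a ∈ Ioi σ₀, θ a = t := fun t ht => by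
    obtain ⟨σ, hσ, hσt⟩ := periodicProfile_exists_clockTime hθ hT hσ₁ ht
    exact ⟨σ, hσ₁.trans hσ, hσt⟩
  have hτmem : ∀ t ∈ V, τ t ∈ Ioi σ₀ := fun t ht => invFunOn_mem (hex t ht)
  have hθτ : ∀ t ∈ V, θ (τ t) = t := fun t ht => invFunOn_eq (hex t ht)
  have hτθ : ∀ σ ∈ Ioi σ₀, τ (θ σ) = σ := fun σ hσ => hmono.injOn.leftInvOn_invFunOn hσ
  have hτgt : ∀ t ∈ V, σ₁ < τ t := fun t ht =>
    (hmono.lt_iff_lt hσ₁ (hτmem t ht)).1 (by rw [hθτ t ht]; exact ht.1)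
  -- `τ` is monotone on `V` with image `⊇ (σ₁, ∞)`, hence continuous on `V`
  have hτmono : MonotoneOn τ V := fun t ht t' ht' htt' =>
    (hmono.le_iff_le (hτmem t ht) (hτmem t' ht')).1 (by rw [hθτ t ht, hθτ t' ht']; exact htt')
  have hτcont : ContinuousOn τ V := by
    intro t ht
    refine (continuousAt_of_monotoneOn_of_image_mem_nhds hτmono (isOpen_Ioo.mem_nhds ht)
      ?_).continuousWithinAt
    refine mem_of_superset (Ioi_mem_nhds (hτgt t ht)) fun σ hσ => ?_
    have hσ₀ : σ ∈ Ioi σ₀ := hσ₁.trans hσ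
    refine ⟨θ σ, ⟨?_, periodicProfile_time_lt hP hpos hθ hT hσ₀⟩, hτθ σ hσ₀⟩
    exact periodicProfile_strictMonoOn_time hpos hθ hσ₁ (show σ₁ ∈ Ici σ₁ from self_mem_Ici)
      (show σ ∈ Ici σ₁ from mem_Ici.2 (le_of_lt hσ)) hσ
  -- the explicit formula on the slab and its continuity
  have hformula : EqOn (uncurry u) (fun z : ℝ × E => ℓ (τ z.1) • W (τ z.1) (ℓ (τ z.1) • z.2))
      (V ×ˢ (univ : Set E)) := by
    rintro ⟨t, x⟩ ⟨ht, -⟩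
    have h := hans (τ t) (hτmem t ht) x
    rw [hθτ t ht] at h
    exact h
  have hℓc : ContinuousOn ℓ (Ioi σ₀) := fun s hs => (hℓ s hs).continuousAt.continuousWithinAt
  have hA : ContinuousOn (fun z : ℝ × E => τ z.1) (V ×ˢ (univ : Set E)) :=
    hτcont.comp continuousOn_fst fun z hz => hz.1
  have hB : ContinuousOn (fun z : ℝ × E => ℓ (τ z.1)) (V ×ˢ (univ : Set E)) :=
    hℓc.comp hA fun z hz => hτmem z.1 hz.1
  have hC : ContinuousOn (fun z : ℝ × E => (τ z.1, ℓ (τ z.1) • z.2)) (V ×ˢ (univ : Set E)) :=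
    hA.prodMk (hB.smul continuousOn_snd)
  have hD : ContinuousOn (fun z : ℝ × E => W (τ z.1) (ℓ (τ z.1) • z.2)) (V ×ˢ (univ : Set E)) :=
    hW.continuous.comp_continuousOn hC
  exact (hB.smul hD).congr hformula

/-! ### §3 Measure vocabulary: `(T, 0)` is not a regular point, `T` is a singular time -/

omit hP hℓ hpos hθ hW hper hperQ hW0 hans hp hu heq in
/-- From an ESSENTIAL bound to a pointwise bound for a continuous field: if `u` is continuous on
`(T₁, T) × E`, `volume` on `ℝ × E` charges nonempty open sets, and `‖u‖ ≤ B` almost everywhere on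
the backward parabolic cylinder `parabolicCylinder ρ (T, 0)` with `T − ρ² ≥ T₁`, then `‖u‖ ≤ B`
everywhere on it (the exceptional set is open and null, hence empty). [folklore] -/
theorem norm_le_of_ae_norm_le_parabolicCylinder [MeasureSpace E] [BorelSpace E]
    [(volume : Measure (ℝ × E)).IsOpenPosMeasure] {T₁ ρ B : ℝ}
    (hcont : ContinuousOn (uncurry u) (Ioo T₁ T ×ˢ univ)) (hρT : T₁ ≤ T - ρ ^ 2)
    (hae : ∀ᵐ z ∂(volume.restrict (parabolicCylinder ρ ((T, 0) : ℝ × E))), ‖u z.1 z.2‖ ≤ B) :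
    ∀ z ∈ parabolicCylinder ρ ((T, 0) : ℝ × E), ‖u z.1 z.2‖ ≤ B := by
  set C : Set (ℝ × E) := parabolicCylinder ρ ((T, 0) : ℝ × E) with hC
  have hCopen : IsOpen C := isOpen_parabolicCylinder ρ _
  have hCsub : C ⊆ Ioo T₁ T ×ˢ univ := by
    rintro ⟨t, x⟩ hz
    rw [hC, mem_parabolicCylinder] at hz
    exact ⟨⟨lt_of_le_of_lt hρT hz.1.1, hz.1.2⟩, mem_univ _⟩
  have hcontC : ContinuousOn (fun z : ℝ × E => ‖u z.1 z.2‖) C :=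
    continuous_norm.comp_continuousOn (hcont.mono hCsub)
  -- the exceptional set `C ∩ {‖u‖ > B}` is open and null, hence empty
  have hopen : IsOpen (C ∩ (fun z : ℝ × E => ‖u z.1 z.2‖) ⁻¹' Ioi B) :=
    hcontC.isOpen_inter_preimage hCopen isOpen_Ioi
  have hnull : volume (C ∩ (fun z : ℝ × E => ‖u z.1 z.2‖) ⁻¹' Ioi B) = 0 := by
    rw [ae_restrict_iff' hCopen.measurableSet] at hae
    rw [← compl_compl (C ∩ _), ← mem_ae_iff]
    filter_upwards [hae] with z hz
    simp only [mem_compl_iff, mem_inter_iff, mem_preimage, mem_Ioi, not_and, not_lt]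
    exact hz
  have hempty := hopen.eq_empty_of_measure_zero hnull
  intro z hz
  by_contra hgt
  have : z ∈ C ∩ (fun z : ℝ × E => ‖u z.1 z.2‖) ⁻¹' Ioi B := ⟨hz, lt_of_not_ge hgt⟩
  rw [hempty] at this
  exact this

/-- **`(T, 0)` IS NOT A REGULAR POINT** (tree `IsRegularPoint`: essential boundedness on a centred
parabolic cylinder — CKN 1982 §6, Seregin 2012 §1; `volume` on `ℝ × E` charging open sets is an
instance, automatic on `ℝ³`). On the blow-up branch `(T, 0)` is not a regular point of `u`: an
essential bound on `Q*_r(T, 0)` restricts to the backward cylinder of radius `min r √(T − θ(σ₀+1))`,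
becomes pointwise by the continuity `periodicProfile_continuousOn`
(`norm_le_of_ae_norm_le_parabolicCylinder`), and contradicts
`periodicProfile_unbounded_near_blowupPoint`. [cite: Seregin2012, §1] -/
theorem periodicProfile_not_isRegularPoint [MeasureSpace E] [BorelSpace E]
    [(volume : Measure (ℝ × E)).IsOpenPosMeasure] (hT : Tendsto θ atTop (𝓝 T)) :
    ¬ IsRegularPoint u ((T, 0) : ℝ × E) := by
  rintro ⟨r, hr, hfin⟩
  have h1 : σ₀ < σ₀ + 1 := lt_add_one σ₀
  have hcont := periodicProfile_continuousOn hP hℓ hpos hθ hW hans hT h1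
  -- the essential bound on the centred cylinder
  set μ : Measure (ℝ × E) := volume.restrict (parabolicCylinderCentered r ((T, 0) : ℝ × E)) with hμ
  set S : ℝ≥0∞ := eLpNorm (uncurry u) ∞ μ with hS
  have hSfin : S < ∞ := hfin
  have haeS : ∀ᵐ z ∂μ, ‖uncurry u z‖ₑ ≤ S := by
    rw [hS, eLpNorm_exponent_top]
    exact ae_le_eLpNormEssSup
  -- a backward cylinder of radius `ρ ≤ r` inside the time range `(θ(σ₀ + 1), T)`
  have hgap : 0 < T - θ (σ₀ + 1) := sub_pos.2 (periodicProfile_time_lt hP hpos hθ hT h1)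
  set ρ : ℝ := min r (Real.sqrt (T - θ (σ₀ + 1))) with hρdef
  have hρ : 0 < ρ := lt_min hr (Real.sqrt_pos.2 hgap)
  have hρr : ρ ≤ r := min_le_left _ _
  have hρT : θ (σ₀ + 1) ≤ T - ρ ^ 2 := by
    have h2 : ρ ^ 2 ≤ Real.sqrt (T - θ (σ₀ + 1)) ^ 2 := pow_le_pow_left₀ hρ.le (min_le_right _ _) 2
    rw [Real.sq_sqrt hgap.le] at h2
    linarith
  have hsub : parabolicCylinder ρ ((T, 0) : ℝ × E) ⊆ parabolicCylinderCentered r ((T, 0) : ℝ × E) := by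
    intro w hw
    rw [mem_parabolicCylinder] at hw
    rw [mem_parabolicCylinderCentered]
    have hρ2 : ρ ^ 2 ≤ r ^ 2 := pow_le_pow_left₀ hρ.le hρr 2
    exact ⟨⟨by linarith [hw.1.1], by nlinarith [hw.1.2, sq_nonneg r]⟩, hw.2.trans_le hρr⟩
  -- a.e. real bound `S.toReal` on the backward cylinder
  have hae : ∀ᵐ z ∂(volume.restrict (parabolicCylinder ρ ((T, 0) : ℝ × E))),
      ‖u z.1 z.2‖ ≤ S.toReal := by
    have h := ae_restrict_of_ae_restrict_of_subset hsub haeS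
    filter_upwards [h] with z hz
    have h2 : ‖u z.1 z.2‖ₑ ≤ S := hz
    have h3 := ENNReal.toReal_mono hSfin.ne h2
    rwa [toReal_enorm] at h3
  have hbd := norm_le_of_ae_norm_le_parabolicCylinder (u := u) hcont hρT hae
  obtain ⟨z, hz, hgt⟩ :=
    periodicProfile_unbounded_near_blowupPoint hP hℓ hpos hθ hW hper hperQ hW0 hans hp hu heq hT hρ
      S.toReal
  exact (hbd z hz).not_gt hgt

/-- **`T` IS A SINGULAR TIME** of the object (tree `IsSingularTime u T`: some `(T, x)` is not a
regular point — here `x = 0`, the centre of the self-similar collapse). Together with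
`periodicProfile_isTypeIBlowup`: a singular time OF TYPE I, never of Type II
(`periodicProfile_not_isTypeIIBlowup`). [cite: Seregin2012, §1] -/
theorem periodicProfile_isSingularTime [MeasureSpace E] [BorelSpace E]
    [(volume : Measure (ℝ × E)).IsOpenPosMeasure] (hT : Tendsto θ atTop (𝓝 T)) :
    IsSingularTime u T :=
  ⟨0, periodicProfile_not_isRegularPoint hP hℓ hpos hθ hW hper hperQ hW0 hans hp hu heq hT⟩

end PeriodicProfile

end Summit.NavierStokesRegularity.FluidComputer.SelfSimilarCensus

end
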